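import Summits.Ventures.PercRepro.ProfilePointedCircuitClassesTwelveCaptureD

/-!
# PercRepro — THE TRIANGLE REGIME OF THE TWELVE-POINT STATEMENT: A THREE-POINT LINE THROUGH A SERIES PAIR,
AVOIDING THE POINT (p5, gen 51; `proofs/P5-GM1.md` §76)

On `#E = 12`, `ρ(E) = 7`, let `{a, a'}` be a series pair (a `2`-cocircuit) and `{a, a', v}` a three-point line
(the three pairs of rank `2`, the triple of rank `2`), with `e ∉ {a, a', v}`.  In the minor `N ／ a` the point
`f = a'` is PARALLEL to `v`, so a set through `a` captures `a'` iff its closure contains `v`.  The capture inequality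
(C) of TwelveCaptureB then holds in the strong form `δ ≤ y` (captured demands ≤ captured units AVOIDING `a'`):
the `n = 10` theorem gives `d_a ≤ u_a` (`card_filter_demands_le_card_filter_units_of_seriesPair`, the transfer of
TwelveCaptureB), and the UNCAPTURED units inject into the UNCAPTURED demands by the canonical map
`S ↦ ((E ∖ S) − a' − v) + a` (`card_filter_uncaptured_units_le_card_filter_uncaptured_demands_of_triangle`:
`v ∉ S`; `(E ∖ S) − a' − v` lies in the hyperplane `E − a − a'`; the complement contains `(S − a) + a' + v` of rank
`7`; the image is uncaptured — both by submodularity against the line; inverse `W ↦ E ∖ ((W − a) + v + a')`).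
Subtracting the two splits: `δ = d_a − #unc(𝒟) ≤ u_a − #unc(𝒰) = y ≤ u₂ + y`.  In the ten-point vocabulary of
§67(d) this is the case «`f` parallel to a point of `N₁`» of (C) (the tight sub-case of (B*), §75 ADD 3), proved
without the `x`-split.  THEOREMS: **`captureIneq_of_triangle`**, **`inCount_five_le_outCount_six_of_triangle`**
(`in_5(e) ≤ out_6(e)` at every `e ∉ {a, a', v}`), `inCount_five_le_outCount_six_of_triangle_of_simple`.  In the dual:
a parallel pair of `M = N✶` inside a `3`-cocircuit decides the twelve-point statement at every other point.
-/

open scoped Matroid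

namespace PercRepro.Cogirth

open Finset ThmH Skew Shadow Profile

variable {α : Type} [DecidableEq α] {N : Matroid α} [N.Finite]

section TwelveTriangle

/-- For `W ∈ BI_5` and a point `a' ∉ W`: `ρ(W + a') ∈ {5, 6}`. -/
theorem rk_insert_eq_five_or_six_of_mem_biIndepSets_five {W : Finset α} (hW : W ∈ biIndepSets N 5) {a' : α}
    (ha'W : a' ∉ W) : rk N (insert a' W) = 5 ∨ rk N (insert a' W) = 6 := by
  obtain ⟨-, hWc, hWr, -⟩ := mem_biIndepSets.1 hW
  have h1 := rk_mono' (M := N) (subset_insert a' W)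
  have h2 := rk_le_card (M := N) (insert a' W)
  rw [card_insert_of_notMem ha'W, hWc] at h2
  rw [hWr, hWc] at h1
  omega

/-- For `S ∈ BI_6` and a point `a' ∉ S`: `ρ(S + a') ∈ {6, 7}`. -/
theorem rk_insert_eq_six_or_seven_of_mem_biIndepSets_six {S : Finset α} (hS : S ∈ biIndepSets N 6) {a' : α}
    (ha'S : a' ∉ S) : rk N (insert a' S) = 6 ∨ rk N (insert a' S) = 7 := by
  obtain ⟨-, hSc, hSr, -⟩ := mem_biIndepSets.1 hS
  have h1 := rk_mono' (M := N) (subset_insert a' S)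
  have h2 := rk_le_card (M := N) (insert a' S)
  rw [card_insert_of_notMem ha'S, hSc] at h2
  rw [hSr, hSc] at h1
  omega

/-- **THE DEMANDS THROUGH `a` SPLIT INTO CAPTURED AND UNCAPTURED ONES**: on `#E = 12`, `ρ(E) = 7`, a demand
through `a` avoids `a'` automatically, and `ρ(W + a') ∈ {5, 6}`. -/
theorem card_filter_demands_eq_add_of_seriesPair (hn : (gr N).card = 12) (hR : rk N (gr N) = 7) {a a' e : α}
    (h : SeriesPair N a a') :
    ((biIndepSets N 5).filter (fun W => (e ∈ W ∧ a ∈ W) ∧ a' ∉ W)).card =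
      ((biIndepSets N 5).filter (fun W => (e ∈ W ∧ a ∈ W) ∧ rk N (insert a' W) = 5)).card +
      ((biIndepSets N 5).filter (fun W => (e ∈ W ∧ a ∈ W) ∧ rk N (insert a' W) = 6)).card := by
  have hn5 : (gr N).card = rk N (gr N) + 5 := by omega
  have h1 := card_filter_add_card_filter_not (s := (biIndepSets N 5).filter (fun W => e ∈ W ∧ a ∈ W))
    (fun W => rk N (insert a' W) = 5)
  rw [filter_filter, filter_filter] at h1
  have e0 : (biIndepSets N 5).filter (fun W => (e ∈ W ∧ a ∈ W) ∧ a' ∉ W) =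
      (biIndepSets N 5).filter (fun W => e ∈ W ∧ a ∈ W) := by
    apply filter_congr
    intro W hW
    exact ⟨fun h' => h'.1, fun h' => ⟨h', not_mem_of_mem_biIndepSets_of_seriesPair h hn5 hW h'.2⟩⟩
  have e1 : (biIndepSets N 5).filter (fun W => (e ∈ W ∧ a ∈ W) ∧ ¬ rk N (insert a' W) = 5) =
      (biIndepSets N 5).filter (fun W => (e ∈ W ∧ a ∈ W) ∧ rk N (insert a' W) = 6) := by
    apply filter_congr
    intro W hW
    constructor
    · rintro ⟨hea, hne⟩
      have ha'W := not_mem_of_mem_biIndepSets_of_seriesPair h hn5 hW hea.2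
      rcases rk_insert_eq_five_or_six_of_mem_biIndepSets_five hW ha'W with h5 | h6
      · exact absurd h5 hne
      · exact ⟨hea, h6⟩
    · rintro ⟨hea, h6⟩
      exact ⟨hea, by omega⟩
  rw [e1] at h1
  rw [e0]
  omega

/-- **THE UNITS THROUGH `a` AVOIDING `a'` SPLIT INTO CAPTURED AND UNCAPTURED ONES**: `ρ(S + a') ∈ {6, 7}`. -/
theorem card_filter_units_eq_add_of_seriesPair {a a' e : α} :
    ((biIndepSets N 6).filter (fun S => (e ∉ S ∧ a ∈ S) ∧ a' ∉ S)).card =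
      ((biIndepSets N 6).filter (fun S => ((e ∉ S ∧ a ∈ S) ∧ a' ∉ S) ∧ rk N (insert a' S) = 6)).card +
      ((biIndepSets N 6).filter (fun S => ((e ∉ S ∧ a ∈ S) ∧ a' ∉ S) ∧ rk N (insert a' S) = 7)).card := by
  have h1 := card_filter_add_card_filter_not (s := (biIndepSets N 6).filter (fun S => (e ∉ S ∧ a ∈ S) ∧ a' ∉ S))
    (fun S => rk N (insert a' S) = 6)
  rw [filter_filter, filter_filter] at h1
  have e1 : (biIndepSets N 6).filter (fun S => ((e ∉ S ∧ a ∈ S) ∧ a' ∉ S) ∧ ¬ rk N (insert a' S) = 6) =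
      (biIndepSets N 6).filter (fun S => ((e ∉ S ∧ a ∈ S) ∧ a' ∉ S) ∧ rk N (insert a' S) = 7) := by
    apply filter_congr
    intro S hS
    constructor
    · rintro ⟨hea, hne⟩
      rcases rk_insert_eq_six_or_seven_of_mem_biIndepSets_six hS hea.2 with h6 | h7
      · exact absurd h6 hne
      · exact ⟨hea, h7⟩
    · rintro ⟨hea, h7⟩
      exact ⟨hea, by omega⟩
  rw [e1] at h1
  omega

/-- **`d_a ≤ u_a`**: the demands through `a` are at most the units through `a` avoiding `a'` — the `n = 10`
theorem `inOutBottomFour_holds` on the minor `N ／ a ∖ a'`, transferred as in TwelveCaptureB. -/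
theorem card_filter_demands_le_card_filter_units_of_seriesPair (hn : (gr N).card = 12) (hR : rk N (gr N) = 7)
    {a a' e : α} (h : SeriesPair N a a') (he : e ∈ gr N) (hea : e ≠ a) (hea' : e ≠ a') :
    ((biIndepSets N 5).filter (fun W => (e ∈ W ∧ a ∈ W) ∧ a' ∉ W)).card ≤
      ((biIndepSets N 6).filter (fun S => (e ∉ S ∧ a ∈ S) ∧ a' ∉ S)).card := by
  have hIa : ∀ W : Finset α, e ∉ insert a W ↔ e ∉ W := by
    intro W
    rw [mem_insert, not_or]
    exact ⟨fun h' => h'.2, fun h' => ⟨hea, h'⟩⟩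
  have hIa' : ∀ W : Finset α, e ∈ insert a' W ↔ e ∈ W := by
    intro W
    rw [mem_insert]
    exact ⟨fun h' => h'.resolve_left hea', fun h' => Or.inr h'⟩
  have hPe : ∀ W : Finset α, e ∈ insert a' (W.erase a) ↔ e ∈ W := by
    intro W
    rw [mem_insert, mem_erase]
    constructor
    · rintro (h' | ⟨_, h'⟩)
      · exact absurd h' hea'
      · exact h'
    · intro h'
      exact Or.inr ⟨hea, h'⟩
  have hPe' : ∀ W : Finset α, e ∈ insert a (W.erase a') ↔ e ∈ W := by
    intro W
    rw [mem_insert, mem_erase]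
    constructor
    · rintro (h' | ⟨_, h'⟩)
      · exact absurd h' hea
      · exact h'
    · intro h'
      exact Or.inr ⟨hea', h'⟩
  have hN₁n := card_gr_minor_add_two_of_seriesPair h
  have hN₁r := rk_gr_minor_add_one_of_seriesPair h
  have he₁ : e ∈ gr ((N ／ ({a} : Set α)) ＼ ({a'} : Set α)) := by
    rw [gr_minor_of_seriesPair]
    exact mem_erase.2 ⟨hea', mem_erase.2 ⟨hea, he⟩⟩
  have h10 := inOutBottomFour_holds (α := α) ((N ／ ({a} : Set α)) ＼ ({a'} : Set α)) e he₁ (by omega) (by omega)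
  unfold inCount outCount at h10
  rw [card_filter_minor_insert_right_eq_of_seriesPair h 4 (fun Y => e ∈ Y) hIa',
    card_filter_minor_insert_left_eq_of_seriesPair h 5 (fun Y => e ∉ Y) hIa] at h10
  simp only [Nat.reduceAdd] at h10
  have hD1 := card_filter_swap_of_seriesPair h 5 (fun W => e ∈ W) hPe hPe'
  omega

/-- An uncaptured unit through `a` avoids `v` when `a' ∈ cl{a, v}`: otherwise `a' ∈ cl S`. -/
theorem notMem_of_rk_insert_eq_seven_of_triangle {S : Finset α} (hSg : S ⊆ gr N) (hSr : rk N S = 6)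
    {a a' v : α} (ha' : a' ∈ gr N) (haS : a ∈ S) (hrk : rk N (insert a' S) = 7) (hcl : a' ∈ clF N {a, v}) :
    v ∉ S := by
  intro hvS
  have hsub : ({a, v} : Finset α) ⊆ S := insert_subset haS (singleton_subset_iff.2 hvS)
  have h1 : a' ∈ clF N S := clF_mono (M := N) hsub hcl
  have h2 := (mem_clF_iff_rk_insert_eq ha' hSg).1 h1
  omega

/-- The inverse of `S ↦ ((E ∖ S) − a' − v) + a`: `E ∖ ((W − a) + v + a') = S`. -/
theorem sdiff_insert_insert_erase_eq {S : Finset α} (hSg : S ⊆ gr N) {a a' v : α} (ha' : a' ∈ gr N)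
    (hv : v ∈ gr N) (haS : a ∈ S) (ha'S : a' ∉ S) (hvS : v ∉ S) (hva' : v ≠ a') :
    gr N \ insert a' (insert v ((insert a (((gr N \ S).erase a').erase v)).erase a)) = S := by
  have haX : a ∉ ((gr N \ S).erase a').erase v :=
    fun h' => (mem_sdiff.1 (mem_of_mem_erase (mem_of_mem_erase h'))).2 haS
  rw [erase_insert haX]
  have hvc : v ∈ (gr N \ S).erase a' := mem_erase.2 ⟨hva', mem_sdiff.2 ⟨hv, hvS⟩⟩
  rw [insert_erase hvc]
  have ha'c : a' ∈ gr N \ S := mem_sdiff.2 ⟨ha', ha'S⟩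
  rw [insert_erase ha'c]
  exact Finset.sdiff_sdiff_eq_self hSg

/-- **THE UNCAPTURED UNITS INJECT INTO THE UNCAPTURED DEMANDS** on a three-point line `{a, a', v}` through the
series pair `{a, a'}`, by `S ↦ ((E ∖ S) − a' − v) + a`. -/
theorem card_filter_uncaptured_units_le_card_filter_uncaptured_demands_of_triangle (hn : (gr N).card = 12)
    {a a' e v : α} (h : SeriesPair N a a') (he : e ∈ gr N) (hea' : e ≠ a') (hv : v ∈ gr N)
    (hva : v ≠ a) (hva' : v ≠ a') (hev : e ≠ v) (haa' : rk N {a, a'} = 2) (hav : rk N {a, v} = 2)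
    (ha'v : rk N {a', v} = 2) (htri : rk N {a, a', v} = 2) :
    ((biIndepSets N 6).filter (fun S => ((e ∉ S ∧ a ∈ S) ∧ a' ∉ S) ∧ rk N (insert a' S) = 7)).card ≤
      ((biIndepSets N 5).filter (fun W => (e ∈ W ∧ a ∈ W) ∧ rk N (insert a' W) = 6)).card := by
  have ha : a ∈ gr N := h.1
  have ha' : a' ∈ gr N := h.2.1
  have hne : a ≠ a' := h.2.2.1
  -- the closure fact of the line used for `v ∉ S`
  have hcl_a' : a' ∈ clF N {a, v} := mem_clF_of_line_triple ha ha' hv hav htri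
  apply card_le_card_of_injOn (fun S => insert a (((gr N \ S).erase a').erase v))
  · intro S hS
    rw [mem_coe, mem_filter] at hS
    obtain ⟨hSb, ⟨⟨heS, haS⟩, ha'S⟩, hrk⟩ := hS
    obtain ⟨hSg, hSc, hSr, hScompl⟩ := mem_biIndepSets.1 hSb
    have hSr6 : rk N S = 6 := by rw [hSr, hSc]
    have hvS : v ∉ S := notMem_of_rk_insert_eq_seven_of_triangle hSg hSr6 ha' haS hrk hcl_a'
    have hec : e ∈ gr N \ S := mem_sdiff.2 ⟨he, heS⟩
    have ha'c : a' ∈ gr N \ S := mem_sdiff.2 ⟨ha', ha'S⟩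
    have hvc : v ∈ gr N \ S := mem_sdiff.2 ⟨hv, hvS⟩
    have hac : a ∉ gr N \ S := fun h' => (mem_sdiff.1 h').2 haS
    have hccard : (gr N \ S).card = 6 := by rw [card_sdiff_of_subset hSg, hn, hSc]
    have hcrk : rk N (gr N \ S) = 6 := by rw [hScompl, hccard]
    -- `X := (E ∖ S) − a' − v`, four points of the hyperplane `E − a − a'`
    have hXsub : ((gr N \ S).erase a').erase v ⊆ gr N \ S := (erase_subset _ _).trans (erase_subset _ _)
    have hXg : ((gr N \ S).erase a').erase v ⊆ gr N := hXsub.trans sdiff_subset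
    have hvX' : v ∈ (gr N \ S).erase a' := mem_erase.2 ⟨hva', hvc⟩
    have hXcard : (((gr N \ S).erase a').erase v).card = 4 := by
      rw [card_erase_of_mem hvX', card_erase_of_mem ha'c, hccard]
    have hXrk : rk N (((gr N \ S).erase a').erase v) = 4 := by
      rw [← hXcard]
      exact rk_eq_card_of_subset_of_rk_eq_card hXsub hScompl
    have haX : a ∉ ((gr N \ S).erase a').erase v := fun h' => hac (hXsub h')
    have ha'X : a' ∉ ((gr N \ S).erase a').erase v := fun h' => (mem_erase.1 (mem_of_mem_erase h')).1 rfl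
    have hvX : v ∉ ((gr N \ S).erase a').erase v := fun h' => (mem_erase.1 h').1 rfl
    have heX : e ∈ ((gr N \ S).erase a').erase v := mem_erase.2 ⟨hev, mem_erase.2 ⟨hea', hec⟩⟩
    have hXhyp : ((gr N \ S).erase a').erase v ⊆ ((gr N).erase a).erase a' := by
      intro x hx
      refine mem_erase.2 ⟨?_, mem_erase.2 ⟨?_, hXg hx⟩⟩
      · intro h'
        rw [h'] at hx
        exact ha'X hx
      · intro h'
        rw [h'] at hx
        exact haX hx
    -- the image `W := X + a` is independent of size `5`
    have hWcard : (insert a (((gr N \ S).erase a').erase v)).card = 5 := by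
      rw [card_insert_of_notMem haX, hXcard]
    have hWrk : rk N (insert a (((gr N \ S).erase a').erase v)) = 5 := by
      rw [rk_insert_left_eq_add_one_of_seriesPair h hXhyp, hXrk]
    -- its complement contains `Z := (S − a) + v + a'`, of rank `7`
    have hZsub : insert a' (insert v (S.erase a)) ⊆ gr N \ insert a (((gr N \ S).erase a').erase v) := by
      intro x hx
      rw [mem_sdiff, mem_insert]
      rcases mem_insert.1 hx with hxa' | hx'
      · rw [hxa']
        exact ⟨ha', fun h' => h'.elim (fun h'' => hne h''.symm) ha'X⟩
      rcases mem_insert.1 hx' with hxv | hx''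
      · rw [hxv]
        exact ⟨hv, fun h' => h'.elim hva hvX⟩
      · obtain ⟨hxa, hxS⟩ := mem_erase.1 hx''
        exact ⟨hSg hxS, fun h' => h'.elim hxa (fun h'' => (mem_sdiff.1 (hXsub h'')).2 hxS)⟩
    have hZrk : 7 ≤ rk N (insert a' (insert v (S.erase a))) := by
      have hsub1 : insert a' S ⊆ insert a' (insert v (S.erase a)) ∪ {a, a', v} := by
        intro x hx
        rcases mem_insert.1 hx with hxa' | hxS
        · rw [hxa']
          exact mem_union.2 (Or.inl (mem_insert_self _ _))
        · by_cases hxa : x = a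
          · rw [hxa]
            exact mem_union.2 (Or.inr (mem_insert_self _ _))
          · exact mem_union.2 (Or.inl (mem_insert_of_mem (mem_insert_of_mem (mem_erase.2 ⟨hxa, hxS⟩))))
      have hsub2 : ({a', v} : Finset α) ⊆ insert a' (insert v (S.erase a)) ∩ {a, a', v} := by
        intro x hx
        rcases mem_insert.1 hx with hxa' | hxv
        · rw [hxa']
          exact mem_inter.2 ⟨mem_insert_self _ _, mem_insert_of_mem (mem_insert_self _ _)⟩
        · rw [mem_singleton] at hxv
          rw [hxv]
          exact mem_inter.2 ⟨mem_insert_of_mem (mem_insert_self _ _),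
            mem_insert_of_mem (mem_insert_of_mem (mem_singleton_self v))⟩
      have hsm := rk_union_add_rk_inter_le (M := N) (insert a' (insert v (S.erase a))) {a, a', v}
      have h1 := rk_mono' (M := N) hsub1
      have h2 := rk_mono' (M := N) hsub2
      rw [hrk] at h1
      rw [ha'v] at h2
      rw [htri] at hsm
      omega
    have hWcompl_card : (gr N \ insert a (((gr N \ S).erase a').erase v)).card = 7 := by
      rw [card_sdiff_of_subset (insert_subset ha hXg), hn, hWcard]
    have hWcompl_rk : rk N (gr N \ insert a (((gr N \ S).erase a').erase v)) = 7 := by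
      have h1 := rk_mono' (M := N) hZsub
      have h2 := rk_le_card (M := N) (gr N \ insert a (((gr N \ S).erase a').erase v))
      rw [hWcompl_card] at h2
      omega
    -- the image is uncaptured: `ρ(W + a') = 6`
    have ha'W : a' ∉ insert a (((gr N \ S).erase a').erase v) :=
      fun h' => (mem_insert.1 h').elim (fun h'' => hne h''.symm) ha'X
    have hW'rk : rk N (insert a' (insert a (((gr N \ S).erase a').erase v))) = 6 := by
      have hle : rk N (insert a' (insert a (((gr N \ S).erase a').erase v))) ≤ 6 := by
        have := rk_le_card (M := N) (insert a' (insert a (((gr N \ S).erase a').erase v)))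
        rw [card_insert_of_notMem ha'W, hWcard] at this
        exact this
      have hge : 6 ≤ rk N (insert a' (insert a (((gr N \ S).erase a').erase v))) := by
        have hsub1 : gr N \ S ⊆ insert a' (insert a (((gr N \ S).erase a').erase v)) ∪ {a, a', v} := by
          intro x hx
          by_cases hxa' : x = a'
          · rw [hxa']
            exact mem_union.2 (Or.inl (mem_insert_self _ _))
          by_cases hxv : x = v
          · rw [hxv]
            exact mem_union.2 (Or.inr (mem_insert_of_mem (mem_insert_of_mem (mem_singleton_self v))))
          · exact mem_union.2 (Or.inl (mem_insert_of_mem (mem_insert_of_mem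
              (mem_erase.2 ⟨hxv, mem_erase.2 ⟨hxa', hx⟩⟩))))
        have hsub2 : ({a, a'} : Finset α) ⊆
            insert a' (insert a (((gr N \ S).erase a').erase v)) ∩ {a, a', v} := by
          intro x hx
          rcases mem_insert.1 hx with hxa | hxa'
          · rw [hxa]
            exact mem_inter.2 ⟨mem_insert_of_mem (mem_insert_self _ _), mem_insert_self _ _⟩
          · rw [mem_singleton] at hxa'
            rw [hxa']
            exact mem_inter.2 ⟨mem_insert_self _ _, mem_insert_of_mem (mem_insert_self _ _)⟩
        have hsm := rk_union_add_rk_inter_le (M := N)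
          (insert a' (insert a (((gr N \ S).erase a').erase v))) {a, a', v}
        have h1 := rk_mono' (M := N) hsub1
        have h2 := rk_mono' (M := N) hsub2
        rw [hcrk] at h1
        rw [haa'] at h2
        rw [htri] at hsm
        omega
      omega
    rw [mem_coe, mem_filter, mem_biIndepSets]
    refine ⟨⟨insert_subset ha hXg, hWcard, ?_, ?_⟩, ⟨mem_insert_of_mem heX, mem_insert_self _ _⟩, hW'rk⟩
    · rw [hWrk, hWcard]
    · rw [hWcompl_rk, hWcompl_card]
  · intro S₁ hS₁ S₂ hS₂ heq
    rw [mem_coe, mem_filter] at hS₁ hS₂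
    obtain ⟨hS₁b, ⟨⟨-, haS₁⟩, ha'S₁⟩, hrk₁⟩ := hS₁
    obtain ⟨hS₂b, ⟨⟨-, haS₂⟩, ha'S₂⟩, hrk₂⟩ := hS₂
    obtain ⟨hS₁g, hS₁c, hS₁r, -⟩ := mem_biIndepSets.1 hS₁b
    obtain ⟨hS₂g, hS₂c, hS₂r, -⟩ := mem_biIndepSets.1 hS₂b
    have hvS₁ : v ∉ S₁ :=
      notMem_of_rk_insert_eq_seven_of_triangle hS₁g (by rw [hS₁r, hS₁c]) ha' haS₁ hrk₁ hcl_a'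
    have hvS₂ : v ∉ S₂ :=
      notMem_of_rk_insert_eq_seven_of_triangle hS₂g (by rw [hS₂r, hS₂c]) ha' haS₂ hrk₂ hcl_a'
    have heq' : insert a (((gr N \ S₁).erase a').erase v) = insert a (((gr N \ S₂).erase a').erase v) := heq
    rw [← sdiff_insert_insert_erase_eq hS₁g ha' hv haS₁ ha'S₁ hvS₁ hva',
      ← sdiff_insert_insert_erase_eq hS₂g ha' hv haS₂ ha'S₂ hvS₂ hva', heq']

/-- **THE CAPTURE INEQUALITY (C) IN THE TRIANGLE REGIME**: on `#E = 12`, `ρ(E) = 7`, for a series pair `{a, a'}`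
on a three-point line `{a, a', v}` and a point `e ∉ {a, a', v}`, the captured demands through `a` are at most the
captured units through `a` — in fact at most those avoiding `a'`:
`δ = d_a − #unc(𝒟) ≤ u_a − #unc(𝒰) = y`. -/
theorem captureIneq_of_triangle (hn : (gr N).card = 12) (hR : rk N (gr N) = 7) {a a' e v : α}
    (h : SeriesPair N a a') (he : e ∈ gr N) (hea : e ≠ a) (hea' : e ≠ a') (hv : v ∈ gr N) (hva : v ≠ a)
    (hva' : v ≠ a') (hev : e ≠ v) (haa' : rk N {a, a'} = 2) (hav : rk N {a, v} = 2) (ha'v : rk N {a', v} = 2)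
    (htri : rk N {a, a', v} = 2) :
    ((biIndepSets N 5).filter (fun W => (e ∈ W ∧ a ∈ W) ∧ rk N (insert a' W) = 5)).card ≤
      ((biIndepSets N 6).filter (fun S => (e ∉ S ∧ a ∈ S) ∧ rk N (insert a' S) = 6)).card := by
  have hD := card_filter_demands_eq_add_of_seriesPair hn hR (e := e) h
  have hU := card_filter_units_eq_add_of_seriesPair (N := N) (a := a) (a' := a') (e := e)
  have hDU := card_filter_demands_le_card_filter_units_of_seriesPair hn hR h he hea hea'
  have hinj := card_filter_uncaptured_units_le_card_filter_uncaptured_demands_of_triangle hn h he hea' hv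
    hva hva' hev haa' hav ha'v htri
  have hsub : ((biIndepSets N 6).filter (fun S => ((e ∉ S ∧ a ∈ S) ∧ a' ∉ S) ∧ rk N (insert a' S) = 6)).card ≤
      ((biIndepSets N 6).filter (fun S => (e ∉ S ∧ a ∈ S) ∧ rk N (insert a' S) = 6)).card := by
    apply card_le_card
    intro S hS
    rw [mem_filter] at hS ⊢
    exact ⟨hS.1, hS.2.1.1, hS.2.2⟩
  omega

/-- **THE TRIANGLE REGIME OF THE TWELVE-POINT STATEMENT**: on `#E = 12`, `ρ(E) = 7`, if `{a, a'}` is a series pair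
lying on a three-point line `{a, a', v}` of `N` (the three pairs of rank `2`, the triple of rank `2`) and
`e ∉ {a, a', v}`, then `in_5(e) ≤ out_6(e)`: the capture inequality holds (`captureIneq_of_triangle`) and the
capture reduction of TwelveCaptureB closes. -/
theorem inCount_five_le_outCount_six_of_triangle (hn : (gr N).card = 12) (hR : rk N (gr N) = 7) {a a' e v : α}
    (h : SeriesPair N a a') (he : e ∈ gr N) (hea : e ≠ a) (hea' : e ≠ a') (hv : v ∈ gr N) (hva : v ≠ a)
    (hva' : v ≠ a') (hev : e ≠ v) (haa' : rk N {a, a'} = 2) (hav : rk N {a, v} = 2) (ha'v : rk N {a', v} = 2)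
    (htri : rk N {a, a', v} = 2) : inCount N 5 e ≤ outCount N 6 e :=
  inCount_five_le_outCount_six_of_seriesPair_of_capture hn hR h he hea hea'
    (captureIneq_of_triangle hn hR h he hea hea' hv hva hva' hev haa' hav ha'v htri)

/-- Two non-parallel non-loops span a rank-`2` pair. -/
theorem rk_pair_eq_two_of_notMem_clF_of_rk_singleton {u w : α} (hu : u ∈ gr N) (hw : w ∈ gr N) (hru : rk N {u} = 1)
    (hnot : w ∉ clF N {u}) : rk N {u, w} = 2 := by
  rw [pair_comm]
  have h1 : ¬ rk N (insert w {u}) = rk N {u} :=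
    fun h' => hnot ((mem_clF_iff_rk_insert_eq hw (singleton_subset_iff.2 hu)).2 h')
  have h2 := rk_mono' (M := N) (subset_insert w ({u} : Finset α))
  have h3 := rk_le_card (M := N) (insert w ({u} : Finset α))
  have h4 := card_insert_le w ({u} : Finset α)
  rw [card_singleton] at h4
  omega

/-- **THE TRIANGLE REGIME ON A SIMPLE MATROID**: the pair ranks of `inCount_five_le_outCount_six_of_triangle`
follow from simplicity (no two distinct non-loops parallel), so a series pair on a three-point line
`{a, a', v}` (`ρ{a, a', v} = 2`, `v` a non-loop) decides `in_5(e) ≤ out_6(e)` at every `e ∉ {a, a', v}`. -/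
theorem inCount_five_le_outCount_six_of_triangle_of_simple (hn : (gr N).card = 12) (hR : rk N (gr N) = 7)
    {a a' e v : α} (h : SeriesPair N a a') (he : e ∈ gr N) (hea : e ≠ a) (hea' : e ≠ a') (hv : v ∈ gr N)
    (hva : v ≠ a) (hva' : v ≠ a') (hev : e ≠ v) (hrv : rk N {v} = 1) (htri : rk N {a, a', v} = 2)
    (hsimple : ∀ u ∈ gr N, ∀ w ∈ gr N, u ≠ w → rk N {u} = 1 → rk N {w} = 1 → w ∉ clF N {u}) :
    inCount N 5 e ≤ outCount N 6 e := by
  have ha : a ∈ gr N := h.1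
  have ha' : a' ∈ gr N := h.2.1
  have hne : a ≠ a' := h.2.2.1
  have hra : rk N {a} = 1 := rk_singleton_eq_one_of_seriesPair h
  have hra' : rk N {a'} = 1 := rk_singleton_eq_one_of_seriesPair h.symm
  have haa' : rk N {a, a'} = 2 := rk_pair_eq_two_of_notMem_clF_of_rk_singleton ha ha' hra (hsimple a ha a' ha' hne hra hra')
  have hav : rk N {a, v} = 2 := rk_pair_eq_two_of_notMem_clF_of_rk_singleton ha hv hra (hsimple a ha v hv hva.symm hra hrv)
  have ha'v : rk N {a', v} = 2 :=
    rk_pair_eq_two_of_notMem_clF_of_rk_singleton ha' hv hra' (hsimple a' ha' v hv hva'.symm hra' hrv)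
  exact inCount_five_le_outCount_six_of_triangle hn hR h he hea hea' hv hva hva' hev haa' hav ha'v htri

end TwelveTriangle

end PercRepro.Cogirth
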